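import Summits.KontsevichZagierPeriods.KontsevichZagierPeriods.Theorems.SymplecticScissorsRealOnePeriodRelations
import Summits.KontsevichZagierPeriods.KontsevichZagierPeriods.Theorems.SymplecticScissorsCurvePeriodsTransferRecord

/-!
# The crux `CurvePeriodsTransfer` (stmt-KontsevichZagierPeriods-11129) — closed

By definition `CurvePeriodsTransfer` is the implication "period conjecture for curve-type periods (Huber–Wüstholz)
⇒ `RealOnePeriodRelations`".  The implication is the theorem
`RealOnePeriodRelations.RealOnePeriodRelations_of_periodConjectureCurveType` of the line `nash-retraction-thin-strip`
(normalisation Ψ of one-dimensional Kontsevich–Zagier representations to real realisations of period symbols through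
the real Puiseux germ, and the retraction Θ with homotopy coherence through semialgebraic chart cells), all of whose
stubs are landed theorems.  [cite: HuberWustholz2022, Thm 13.3 (2)] [cite: KontsevichZagier2001, §1.2]

REPAIR 2026-08-17 (importer-rebuild breakage after p132731, "22:4: Unknown identifier
`…Theses.SymplecticScissors.CurvePeriodsTransfer`"): the items-cap lint autofix of 2026-08-16T14:16:23Z dropped the item
from route `SymplecticScissors`; the constant is re-declared verbatim (ledger signature of stmt-11129) in
`Theorems/SymplecticScissorsCurvePeriodsTransferRecord.lean` (p132644), now imported, so the append-only header below
elaborates unchanged; the proof term uses the non-deprecated name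
`realOnePeriodRelations_of_huberWustholzCurvePeriods` (p132731 deprecated `RealOnePeriodRelations_of_periodConjectureCurveType`).
-/

noncomputable section

namespace Summit.KontsevichZagierPeriods.SymplecticScissors.CurvePeriodsTransfer

/-- **The crux `CurvePeriodsTransfer`.** The period conjecture for periods of curve type implies that every
`ℤ`-relation among effective one-dimensional Kontsevich–Zagier periods is generated by the one-dimensional scissors
moves (1a), (1b), (2) and the semialgebraic Green move. [cite: HuberWustholz2022, Thm 13.3 (2)] -/
theorem curvePeriodsTransfer_proof :
    Summit.KontsevichZagierPeriods.KontsevichZagierPeriods.Theses.SymplecticScissors.CurvePeriodsTransfer :=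
  RealOnePeriodRelations.realOnePeriodRelations_of_huberWustholzCurvePeriods

end Summit.KontsevichZagierPeriods.SymplecticScissors.CurvePeriodsTransfer

end
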